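/-
Origin: expansion seat `planner-pub-hodgecm-toy2-0`, handover #3 2026-08-18T03:38:44Z (`HOME/pub-hodgecm-toy2/lean/Models/ThetaSeparation.lean`, md5 27111fc3, 334 lines);
landed by the gen-5 packager in gate run 19 as `HodgeCM/Model/ThetaSeparation.lean` (verbatim).
-/
/-
Origin: consistency seat 2 — session planner-pub-hodgecm-toy2-0 (unit pub-hodgecm-toy2).  WIP module
`Models.ThetaSeparation`; intended final place `HodgeCM/Model/ThetaSeparation.lean` (imports `…Model.NonVacuity`).
Nothing is asserted: every statement is proved from the package's definitions (no new constants).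
-/
import Summits.HodgeConjecture.HodgeCM.Model.NonVacuity

set_option autoImplicit false

/-!
# Separating models for single PerL open inputs of the theta record

`Models.NonVacuity` separates the two PRINT facts that tie `L²([G_U])` to the quadrilinear period
(`Fact_innerEmb`, `Fact_hodgeRiemann20`) by the period-free shadow.  The six PerL-internal `Open_…` inputs of
`ThetaModel.Inputs` do not mention the trace, so the shadow leaves them unchanged.  Three of them are separated
here INDIVIDUALLY by changing only the theta one-forms `T.Theta` of a theta model `T` over the SAME universe `U`
(so all 28 model facts, `Fact_hodgeRiemann20`, `PohlmannSpan`, `Qw8Sufficiency`, `HC_CM` keep their truth values):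

* `Open_thetaWedge` (PerL Prop 4.3, node N33): `T.drop01` forgets the theta one-forms of types `Ψ₀, Ψ₁`.  It
  satisfies the other NINE inputs whenever `T` does, and REFUTES `Open_thetaWedge` outright (given the two design
  constraints and Landherr's lemma, which make a good context exist: `ThetaModel.exists_goodCtx`).
* `Open_thetaReal34` (PerL Lemma 3.5, generation direction, node N19g): `T.drop23` forgets the forms of types
  `Ψ₂, Ψ₃`.  It satisfies the other nine inputs whenever `T` does, and refutes `Open_thetaReal34` whenever
  `(U, T) ⊨ ModelAxioms ∧ Inputs ∧ Fact_hodgeRiemann20`: then some generator `ϑ_{T',χ}(Φ)` of `S₃₄` is nonzero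
  (`exists_theta34_ne_zero`: Prop 4.3's wedge is a nonzero vector of `S₁₂ = S₃₄`, Thm 3.7), but `drop23` has no
  (34)-wedges.
* `Open_thetaSub` (PerL Lemma 3.3(a) + Prop 2.2, node N12): `T.conj02` ADDS to the type-`Ψ₂` forms the complex
  conjugates of the type-`Ψ₀` forms.  It satisfies the other nine inputs whenever `T` does (more (34)-wedges only
  help `Open_thetaReal34`), and refutes `Open_thetaSub` whenever `U ⊨ Fact_pull_hodge` and `T ⊨ thetaSub ∧
  thetaWedge`: a nonzero type-`Ψ₀` theta form `ω₁` is holomorphic, so `conj ω₁ ∉ H^{1,0} ⊇ U_{Ψ₂}`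
  (`Universe.eq_zero_of_conj_mem_H10`, Hodge symmetry of the vendored `HodgeStructure`).

Consequently none of these three inputs is derivable from the 28 model facts + `Fact_hodgeRiemann20` + the other
nine theta inputs + `Lemma33bLandherr` (+ `PohlmannSpan`, `Qw8Sufficiency`), relative to the consistency of that
whole list (`exists_model_not_thetaWedge/thetaReal34/thetaSub`; `Lemma33bLandherr` is a THEOREM since run 22 —
`HodgeCM.lemma33bLandherr_holds` — and the forms without that hypothesis are `…''` in `Proofs/LandherrDischarge.lean`).  NOT separated individually (and why): the
torus-side inputs `Open_thetaGen12`, `Open_chars`, `Open_occ` are entangled with each other through the axioms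
of `Perl34.TorusData` (`S12_def` pins `S₁₂` to the allowed characters; `AX8_annihilation`/`AX9_w_vector` tie
`wOccurs` to the projection `P_w`), so killing one of them by re-choosing the torus data kills another; the two
DESIGN constraints and `Fact_embCover` are definitional / functorial and not adjudication targets.
-/

noncomputable section

open scoped InnerProductSpace

namespace HodgeCM

open Literature.AlgebraicGeometry.Motives (CMType HodgeStructure)
open Literature.AlgebraicGeometry.Motives.HodgeStructure (conj)
open HodgeCM.Prior.Perl34File

namespace Universe

variable {U : Universe}

/-- Hodge symmetry in degree one: a class `ω ∈ H^{1,0}` whose conjugate is also in `H^{1,0}` vanishes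
(`F¹ ⊓ conj F¹ = 0` for a weight-one Hodge structure). -/
theorem eq_zero_of_conj_mem_H10 (X : U.Var) {ω : U.CohC X 1} (hω : ω ∈ U.H10 X) (hc : conj ω ∈ U.H10 X) :
    ω = 0 := by
  have h1 : conj ω ∈ (U.hodge X 1).F 1 := (HodgeStructure.piece_le_F _ 1 0) hc
  have h2 : conj ω ∈ HodgeStructure.complexConj ((U.hodge X 1).F 1) :=
    (HodgeStructure.piece_le_complexConj_F _ 0 1) (HodgeStructure.conj_mem_piece _ hω)
  have hbot := ((U.hodge X 1).isCompl_F_complexConj 1 1 (by norm_num)).disjoint.eq_bot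
  have hmem : conj ω ∈ (U.hodge X 1).F 1 ⊓ HodgeStructure.complexConj ((U.hodge X 1).F 1) := ⟨h1, h2⟩
  rw [hbot, Submodule.mem_bot] at hmem
  rw [← HodgeStructure.conj_conj ω, hmem, map_zero]

namespace ThetaModel

variable (T : U.ThetaModel)

/-- A good context exists for every theta model satisfying the two design constraints, given Landherr's lemma:
surface field `ℚ(ζ₇)` with the standard CM type and a two-place face (`faceHypothesesInhabited`), a hermitian
space from `landherr_exists_proof`, the seesaw datum from `exists_seesawDatum`. -/
theorem exists_goodCtx (hκ : T.Design_kappaConj) (hs : T.Design_frameSignConj) (hL : Lemma33bLandherr) :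
    ∃ (F : CMField) (ι₁ : F →+* ℂ) (_ : HermSpace3 F ι₁) (c : SeesawCtx F), T.GoodCtx ι₁ c := by
  obtain ⟨F, -, -, f, ι₁, hadm⟩ := faceHypothesesInhabited
  obtain ⟨V⟩ := landherr_exists_proof F ι₁
  obtain ⟨D, hD⟩ := T.exists_seesawDatum hκ hs hL (RingHom.id F) ι₁ f.psi (pairSum_psi f)
  exact ⟨F, ι₁, V, ⟨F, f.psi, ι₁, D⟩, ⟨pairSum_psi f, StubTree.psi_injective F f, admissible_mem_psi f ι₁ hadm,
    ⟨RingHom.id F, RingHom.comp_id ι₁, hD⟩⟩⟩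

/-- In a good context of a theta model with all inputs, over a model of the 28 facts with Hodge–Riemann `(2,0)`,
SOME generator `ϑ_{T',χ}(Φ)` of `S₃₄` is nonzero: Prop 4.3's wedge `ω₁ ∧ ω₂` is a nonzero vector
(`emb_ne_zero`) of `S₁₂` (`thetaGen12`) `= S₃₄` (Thm 3.7, `IsolationSetting.C2_S12_eq_S34`, hypotheses from
`chars`/`occ`), and a nonzero vector of the closed span of the generators pairs non-trivially with one of them. -/
theorem exists_theta34_ne_zero (M : U.ModelAxioms) (A : T.Inputs) (hHR : U.Fact_hodgeRiemann20)
    {L : CMField} {ι₁ : L →+* ℂ} (V : HermSpace3 L ι₁) (c : SeesawCtx L) (hc : T.GoodCtx ι₁ c) :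
    ∃ χ : (T.t34 V c).X, (T.t34 V c).allowed χ ∧ ∃ Φ : T.SK V c, (T.t34 V c).ϑ χ Φ ≠ 0 := by
  have hH10 : ∀ (i : Fin 4) (Γ : Level V), ∀ ω ∈ T.Theta V c i Γ, ω ∈ U.H10 (U.pms L ι₁ V Γ) :=
    fun i Γ ω hω => U.Uiso_le_H10 M.pull_hodge Γ c.K (c.Ψ i) c.σ (A.thetaSub V c hc i Γ hω)
  obtain ⟨Γ, ω₁, h₁, ω₂, h₂, hne⟩ := A.thetaWedge V c hc
  have hv : T.Λ Γ ω₁ ω₂ ≠ 0 :=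
    T.emb_ne_zero M A.innerEmb hHR Γ (cup2C_mem_F2 M _ (hH10 0 Γ ω₁ h₁) (hH10 1 Γ ω₂ h₂)) hne
  let S : Perl34.IsolationSetting (T.H V c) (T.HG L ι₁ V) (T.CG V c) (T.G V c) (T.SK V c) (T.SigIdx V c)
      (T.SigIdxG V c) :=
    { core := T.core V c, t12 := T.t12 V c, t34 := T.t34 V c
      H_chars12 := (A.chars V c hc).1, H_chars34 := (A.chars V c hc).2
      H_occ12 := (A.occ V c hc).1, H_occ34 := (A.occ V c hc).2 }
  have hvS : T.Λ Γ ω₁ ω₂ ∈ (T.t34 V c).S12 := by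
    have h := A.thetaGen12 V c hc Γ ω₁ ω₂ h₁ h₂
    have e : (T.t12 V c).S12 = (T.t34 V c).S12 := S.C2_S12_eq_S34
    rwa [e] at h
  rw [(T.t34 V c).S12_def] at hvS
  obtain ⟨u, ⟨χ, hχ, Φ, rfl⟩, hu⟩ :=
    StubTree.exists_inner_ne_zero_of_mem_closure_span (inner_self_ne_zero.mpr hv) hvS
  refine ⟨χ, hχ, Φ, fun h0 => hu ?_⟩
  change ⟪T.Λ Γ ω₁ ω₂, (T.t34 V c).ϑ χ Φ⟫_ℂ = 0
  rw [h0, inner_zero_right]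

/-! ## Re-choosing the theta one-forms -/

/-- The theta model `T` with its theta one-forms replaced by `Θ` (all other data unchanged). -/
def withTheta (Θ : ∀ {L : CMField} {ι₁ : L →+* ℂ} (V : HermSpace3 L ι₁), SeesawCtx L → Fin 4 →
    ∀ Γ : Level V, Set (U.CohC (U.pms L ι₁ V Γ) 1)) : U.ThetaModel :=
  { T with Theta := Θ }

section withTheta

variable (Θ : ∀ {L : CMField} {ι₁ : L →+* ℂ} (V : HermSpace3 L ι₁), SeesawCtx L → Fin 4 →
    ∀ Γ : Level V, Set (U.CohC (U.pms L ι₁ V Γ) 1))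

/-- (Ported verbatim from the HodgeCMPerL package; no docstring in the source.) -/
theorem withTheta_goodCtx_iff {L : CMField} (ι₁ : L →+* ℂ) (c : SeesawCtx L) :
    (T.withTheta Θ).GoodCtx ι₁ c ↔ T.GoodCtx ι₁ c :=
  ⟨fun ⟨h1, h2, h3, h4⟩ => ⟨h1, h2, h3, h4⟩, fun ⟨h1, h2, h3, h4⟩ => ⟨h1, h2, h3, h4⟩⟩

/-- (Ported verbatim from the HodgeCMPerL package; no docstring in the source.) -/
theorem withTheta_embCover_iff : (T.withTheta Θ).Fact_embCover ↔ T.Fact_embCover := Iff.rfl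
/-- (Ported verbatim from the HodgeCMPerL package; no docstring in the source.) -/
theorem withTheta_innerEmb_iff : (T.withTheta Θ).Fact_innerEmb ↔ T.Fact_innerEmb := Iff.rfl
/-- (Ported verbatim from the HodgeCMPerL package; no docstring in the source.) -/
theorem withTheta_kappaConj_iff : (T.withTheta Θ).Design_kappaConj ↔ T.Design_kappaConj := Iff.rfl
/-- (Ported verbatim from the HodgeCMPerL package; no docstring in the source.) -/
theorem withTheta_frameSignConj_iff : (T.withTheta Θ).Design_frameSignConj ↔ T.Design_frameSignConj := Iff.rfl
/-- (Ported verbatim from the HodgeCMPerL package; no docstring in the source.) -/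
theorem withTheta_chars_iff : (T.withTheta Θ).Open_chars ↔ T.Open_chars :=
  ⟨fun h _ ι₁ V c hc => h V c ((T.withTheta_goodCtx_iff Θ ι₁ c).mpr hc),
    fun h _ ι₁ V c hc => h V c ((T.withTheta_goodCtx_iff Θ ι₁ c).mp hc)⟩
/-- (Ported verbatim from the HodgeCMPerL package; no docstring in the source.) -/
theorem withTheta_occ_iff : (T.withTheta Θ).Open_occ ↔ T.Open_occ :=
  ⟨fun h _ ι₁ V c hc => h V c ((T.withTheta_goodCtx_iff Θ ι₁ c).mpr hc),
    fun h _ ι₁ V c hc => h V c ((T.withTheta_goodCtx_iff Θ ι₁ c).mp hc)⟩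

/-- `Open_thetaSub` for the re-chosen forms, spelled out over `T`'s good contexts. -/
theorem withTheta_thetaSub_iff : (T.withTheta Θ).Open_thetaSub ↔
    ∀ {L : CMField} {ι₁ : L →+* ℂ} (V : HermSpace3 L ι₁) (c : SeesawCtx L), T.GoodCtx ι₁ c →
      ∀ (i : Fin 4) (Γ : Level V), Θ V c i Γ ⊆ U.Uiso Γ c.K (c.Ψ i) c.σ :=
  ⟨fun h _ ι₁ V c hc => h V c ((T.withTheta_goodCtx_iff Θ ι₁ c).mpr hc),
    fun h _ ι₁ V c hc => h V c ((T.withTheta_goodCtx_iff Θ ι₁ c).mp hc)⟩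

/-- `Open_thetaWedge` for the re-chosen forms. -/
theorem withTheta_thetaWedge_iff : (T.withTheta Θ).Open_thetaWedge ↔
    ∀ {L : CMField} {ι₁ : L →+* ℂ} (V : HermSpace3 L ι₁) (c : SeesawCtx L), T.GoodCtx ι₁ c →
      ∃ Γ : Level V, ∃ ω₁ ∈ Θ V c 0 Γ, ∃ ω₂ ∈ Θ V c 1 Γ, U.cup2C (U.pms L ι₁ V Γ) 1 ω₁ ω₂ ≠ 0 :=
  ⟨fun h _ ι₁ V c hc => h V c ((T.withTheta_goodCtx_iff Θ ι₁ c).mpr hc),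
    fun h _ ι₁ V c hc => h V c ((T.withTheta_goodCtx_iff Θ ι₁ c).mp hc)⟩

/-- `Open_thetaGen12` for the re-chosen forms (`Λ` and `S₁₂` are `T`'s). -/
theorem withTheta_thetaGen12_iff : (T.withTheta Θ).Open_thetaGen12 ↔
    ∀ {L : CMField} {ι₁ : L →+* ℂ} (V : HermSpace3 L ι₁) (c : SeesawCtx L), T.GoodCtx ι₁ c →
      ∀ (Γ : Level V) (ω₁ ω₂ : U.CohC (U.pms L ι₁ V Γ) 1), ω₁ ∈ Θ V c 0 Γ → ω₂ ∈ Θ V c 1 Γ →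
        T.Λ Γ ω₁ ω₂ ∈ (T.t12 V c).S12 :=
  ⟨fun h _ ι₁ V c hc => h V c ((T.withTheta_goodCtx_iff Θ ι₁ c).mpr hc),
    fun h _ ι₁ V c hc => h V c ((T.withTheta_goodCtx_iff Θ ι₁ c).mp hc)⟩

/-- `Open_thetaReal34` for the re-chosen forms (the (34)-wedge set is formed from `Θ 2`, `Θ 3`). -/
theorem withTheta_thetaReal34_iff : (T.withTheta Θ).Open_thetaReal34 ↔
    ∀ {L : CMField} {ι₁ : L →+* ℂ} (V : HermSpace3 L ι₁) (c : SeesawCtx L), T.GoodCtx ι₁ c →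
      ∀ χ : (T.t34 V c).X, (T.t34 V c).allowed χ → ∀ Φ : T.SK V c,
        (T.t34 V c).ϑ χ Φ ∈ (Submodule.span ℂ
          {x | ∃ Γ : Level V, ∃ ω ∈ Θ V c 2 Γ, ∃ ω' ∈ Θ V c 3 Γ, x = T.Λ Γ ω ω'}).topologicalClosure :=
  ⟨fun h _ ι₁ V c hc => h V c ((T.withTheta_goodCtx_iff Θ ι₁ c).mpr hc),
    fun h _ ι₁ V c hc => h V c ((T.withTheta_goodCtx_iff Θ ι₁ c).mp hc)⟩

end withTheta

/-! ## 1. `Open_thetaWedge` (Prop 4.3): drop the forms of types `Ψ₀, Ψ₁` -/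

/-- `T` without theta one-forms of types `Ψ₀`, `Ψ₁`. -/
def drop01 : U.ThetaModel :=
  T.withTheta fun V c i Γ => {ω | ω ∈ T.Theta V c i Γ ∧ (i = 2 ∨ i = 3)}

/-- `drop01` satisfies every input other than `Open_thetaWedge` that `T` satisfies … -/
theorem drop01_inputs (A : T.Inputs) :
    T.drop01.Fact_embCover ∧ T.drop01.Fact_innerEmb ∧ T.drop01.Design_kappaConj ∧
      T.drop01.Design_frameSignConj ∧ T.drop01.Open_thetaSub ∧ T.drop01.Open_thetaGen12 ∧
      T.drop01.Open_thetaReal34 ∧ T.drop01.Open_chars ∧ T.drop01.Open_occ := by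
  refine ⟨A.embCover, A.innerEmb, A.kappaConj, A.frameSignConj, ?_, ?_, ?_,
    (T.withTheta_chars_iff _).mpr A.chars, (T.withTheta_occ_iff _).mpr A.occ⟩
  · exact (T.withTheta_thetaSub_iff _).mpr fun V c hc i Γ ω hω => A.thetaSub V c hc i Γ hω.1
  · exact (T.withTheta_thetaGen12_iff _).mpr fun V c hc Γ ω₁ ω₂ h₁ _ => absurd h₁.2 (by decide)
  · refine (T.withTheta_thetaReal34_iff _).mpr fun V c hc χ hχ Φ => ?_
    refine (Submodule.topologicalClosure_mono (Submodule.span_mono ?_)) (A.thetaReal34 V c hc χ hχ Φ)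
    rintro x ⟨Γ, ω, hω, ω', hω', rfl⟩
    exact ⟨Γ, ω, ⟨hω, Or.inl rfl⟩, ω', ⟨hω', Or.inr rfl⟩, rfl⟩

/-- … and REFUTES `Open_thetaWedge` (a good context exists, and `drop01` has no type-`Ψ₀` forms). -/
theorem drop01_not_thetaWedge (hκ : T.Design_kappaConj) (hs : T.Design_frameSignConj) (hL : Lemma33bLandherr) :
    ¬ T.drop01.Open_thetaWedge := by
  intro hw
  obtain ⟨F, ι₁, V, c, hc⟩ := T.exists_goodCtx hκ hs hL
  obtain ⟨Γ, ω₁, h₁, -⟩ := (T.withTheta_thetaWedge_iff _).mp hw V c hc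
  exact absurd h₁.2 (by decide)

/-- **Separating model for `Open_thetaWedge`.**  Over the SAME universe: if `T ⊨ Inputs` then `T.drop01` satisfies
the other nine inputs and refutes Prop 4.3 (given Landherr's lemma). -/
theorem separating_thetaWedge (A : T.Inputs) (hL : Lemma33bLandherr) :
    (T.drop01.Fact_embCover ∧ T.drop01.Fact_innerEmb ∧ T.drop01.Design_kappaConj ∧
      T.drop01.Design_frameSignConj ∧ T.drop01.Open_thetaSub ∧ T.drop01.Open_thetaGen12 ∧
      T.drop01.Open_thetaReal34 ∧ T.drop01.Open_chars ∧ T.drop01.Open_occ) ∧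
    ¬ T.drop01.Open_thetaWedge :=
  ⟨T.drop01_inputs A, T.drop01_not_thetaWedge A.kappaConj A.frameSignConj hL⟩

/-! ## 2. `Open_thetaReal34` (Lemma 3.5, generation): drop the forms of types `Ψ₂, Ψ₃` -/

/-- `T` without theta one-forms of types `Ψ₂`, `Ψ₃`. -/
def drop23 : U.ThetaModel :=
  T.withTheta fun V c i Γ => {ω | ω ∈ T.Theta V c i Γ ∧ (i = 0 ∨ i = 1)}

/-- (Ported verbatim from the HodgeCMPerL package; no docstring in the source.) -/
theorem drop23_inputs (A : T.Inputs) :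
    T.drop23.Fact_embCover ∧ T.drop23.Fact_innerEmb ∧ T.drop23.Design_kappaConj ∧
      T.drop23.Design_frameSignConj ∧ T.drop23.Open_thetaSub ∧ T.drop23.Open_thetaWedge ∧
      T.drop23.Open_thetaGen12 ∧ T.drop23.Open_chars ∧ T.drop23.Open_occ := by
  refine ⟨A.embCover, A.innerEmb, A.kappaConj, A.frameSignConj, ?_, ?_, ?_,
    (T.withTheta_chars_iff _).mpr A.chars, (T.withTheta_occ_iff _).mpr A.occ⟩
  · exact (T.withTheta_thetaSub_iff _).mpr fun V c hc i Γ ω hω => A.thetaSub V c hc i Γ hω.1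
  · refine (T.withTheta_thetaWedge_iff _).mpr fun V c hc => ?_
    obtain ⟨Γ, ω₁, h₁, ω₂, h₂, hne⟩ := A.thetaWedge V c hc
    exact ⟨Γ, ω₁, ⟨h₁, Or.inl rfl⟩, ω₂, ⟨h₂, Or.inr rfl⟩, hne⟩
  · exact (T.withTheta_thetaGen12_iff _).mpr fun V c hc Γ ω₁ ω₂ h₁ h₂ =>
      A.thetaGen12 V c hc Γ ω₁ ω₂ h₁.1 h₂.1

/-- `drop23` refutes `Open_thetaReal34` as soon as some generator of `S₃₄` is nonzero in some good context —
which holds when `(U, T) ⊨ ModelAxioms ∧ Inputs ∧ Fact_hodgeRiemann20` (`exists_theta34_ne_zero`). -/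
theorem drop23_not_thetaReal34 (M : U.ModelAxioms) (A : T.Inputs) (hHR : U.Fact_hodgeRiemann20)
    (hL : Lemma33bLandherr) : ¬ T.drop23.Open_thetaReal34 := by
  intro hr
  obtain ⟨F, ι₁, V, c, hc⟩ := T.exists_goodCtx A.kappaConj A.frameSignConj hL
  obtain ⟨χ, hχ, Φ, hne⟩ := T.exists_theta34_ne_zero M A hHR V c hc
  have hmem := (T.withTheta_thetaReal34_iff _).mp hr V c hc χ hχ Φ
  obtain ⟨u, ⟨Γ, ω, hω, -⟩, -⟩ :=
    StubTree.exists_inner_ne_zero_of_mem_closure_span (inner_self_ne_zero.mpr hne) hmem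
  exact absurd hω.2 (by decide)

/-- **Separating model for `Open_thetaReal34`.** -/
theorem separating_thetaReal34 (M : U.ModelAxioms) (A : T.Inputs) (hHR : U.Fact_hodgeRiemann20)
    (hL : Lemma33bLandherr) :
    (T.drop23.Fact_embCover ∧ T.drop23.Fact_innerEmb ∧ T.drop23.Design_kappaConj ∧
      T.drop23.Design_frameSignConj ∧ T.drop23.Open_thetaSub ∧ T.drop23.Open_thetaWedge ∧
      T.drop23.Open_thetaGen12 ∧ T.drop23.Open_chars ∧ T.drop23.Open_occ) ∧
    ¬ T.drop23.Open_thetaReal34 :=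
  ⟨T.drop23_inputs A, T.drop23_not_thetaReal34 M A hHR hL⟩

/-! ## 3. `Open_thetaSub` (typing): add conjugates of type-`Ψ₀` forms to type `Ψ₂` -/

/-- `T` with the complex conjugates of the type-`Ψ₀` theta forms ADDED to the type-`Ψ₂` forms. -/
def conj02 : U.ThetaModel :=
  T.withTheta fun V c i Γ => {ω | ω ∈ T.Theta V c i Γ ∨ (i = 2 ∧ conj ω ∈ T.Theta V c 0 Γ)}

/-- (Ported verbatim from the HodgeCMPerL package; no docstring in the source.) -/
theorem conj02_inputs (A : T.Inputs) :
    T.conj02.Fact_embCover ∧ T.conj02.Fact_innerEmb ∧ T.conj02.Design_kappaConj ∧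
      T.conj02.Design_frameSignConj ∧ T.conj02.Open_thetaWedge ∧ T.conj02.Open_thetaGen12 ∧
      T.conj02.Open_thetaReal34 ∧ T.conj02.Open_chars ∧ T.conj02.Open_occ := by
  refine ⟨A.embCover, A.innerEmb, A.kappaConj, A.frameSignConj, ?_, ?_, ?_,
    (T.withTheta_chars_iff _).mpr A.chars, (T.withTheta_occ_iff _).mpr A.occ⟩
  · refine (T.withTheta_thetaWedge_iff _).mpr fun V c hc => ?_
    obtain ⟨Γ, ω₁, h₁, ω₂, h₂, hne⟩ := A.thetaWedge V c hc
    exact ⟨Γ, ω₁, Or.inl h₁, ω₂, Or.inl h₂, hne⟩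
  · refine (T.withTheta_thetaGen12_iff _).mpr fun V c hc Γ ω₁ ω₂ h₁ h₂ => ?_
    rcases h₁ with h₁ | ⟨h, -⟩
    · rcases h₂ with h₂ | ⟨h, -⟩
      · exact A.thetaGen12 V c hc Γ ω₁ ω₂ h₁ h₂
      · exact absurd h (by decide)
    · exact absurd h (by decide)
  · refine (T.withTheta_thetaReal34_iff _).mpr fun V c hc χ hχ Φ => ?_
    refine (Submodule.topologicalClosure_mono (Submodule.span_mono ?_)) (A.thetaReal34 V c hc χ hχ Φ)
    rintro x ⟨Γ, ω, hω, ω', hω', rfl⟩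
    exact ⟨Γ, ω, Or.inl hω, ω', Or.inl hω', rfl⟩

/-- `conj02` refutes `Open_thetaSub` whenever `U ⊨ Fact_pull_hodge` and `T ⊨ thetaSub ∧ thetaWedge` (and a good
context exists): Prop 4.3's `ω₁ ≠ 0` is holomorphic, so `conj ω₁ ∉ H^{1,0} ⊇ U_{Ψ₂}` by Hodge symmetry. -/
theorem conj02_not_thetaSub (hH : U.Fact_pull_hodge) (hκ : T.Design_kappaConj) (hs : T.Design_frameSignConj)
    (hsub : T.Open_thetaSub) (hw : T.Open_thetaWedge) (hL : Lemma33bLandherr) : ¬ T.conj02.Open_thetaSub := by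
  intro h
  obtain ⟨F, ι₁, V, c, hc⟩ := T.exists_goodCtx hκ hs hL
  obtain ⟨Γ, ω₁, h₁, ω₂, h₂, hne⟩ := hw V c hc
  have hω₁ : ω₁ ∈ U.H10 (U.pms F ι₁ V Γ) := U.Uiso_le_H10 hH Γ c.K (c.Ψ 0) c.σ (hsub V c hc 0 Γ h₁)
  have hcj : conj ω₁ ∈ U.H10 (U.pms F ι₁ V Γ) := by
    refine U.Uiso_le_H10 hH Γ c.K (c.Ψ 2) c.σ ((T.withTheta_thetaSub_iff _).mp h V c hc 2 Γ ?_)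
    exact Or.inr ⟨rfl, by rw [HodgeStructure.conj_conj]; exact h₁⟩
  have h0 : ω₁ = 0 := U.eq_zero_of_conj_mem_H10 _ hω₁ hcj
  exact hne (by rw [h0, LinearMap.map_zero₂])

/-- **Separating model for `Open_thetaSub`.** -/
theorem separating_thetaSub (hH : U.Fact_pull_hodge) (A : T.Inputs) (hL : Lemma33bLandherr) :
    (T.conj02.Fact_embCover ∧ T.conj02.Fact_innerEmb ∧ T.conj02.Design_kappaConj ∧
      T.conj02.Design_frameSignConj ∧ T.conj02.Open_thetaWedge ∧ T.conj02.Open_thetaGen12 ∧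
      T.conj02.Open_thetaReal34 ∧ T.conj02.Open_chars ∧ T.conj02.Open_occ) ∧
    ¬ T.conj02.Open_thetaSub :=
  ⟨T.conj02_inputs A, T.conj02_not_thetaSub hH A.kappaConj A.frameSignConj A.thetaSub A.thetaWedge hL⟩

end ThetaModel

end Universe

/-! ## Packaging: relative to the consistency of the intended record, three more inputs carry content -/

/-- `Open_thetaWedge` is not derivable from the rest: a model of everything but Prop 4.3, refuting it. -/
theorem exists_model_not_thetaWedge (hL : Lemma33bLandherr)
    (h : ∃ (U : Universe) (T : U.ThetaModel), U.ModelAxioms ∧ T.Inputs ∧ U.Fact_hodgeRiemann20) :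
    ∃ (U : Universe) (T : U.ThetaModel), U.ModelAxioms ∧ U.Fact_hodgeRiemann20 ∧
      (T.Fact_embCover ∧ T.Fact_innerEmb ∧ T.Design_kappaConj ∧ T.Design_frameSignConj ∧ T.Open_thetaSub ∧
        T.Open_thetaGen12 ∧ T.Open_thetaReal34 ∧ T.Open_chars ∧ T.Open_occ) ∧
      ¬ T.Open_thetaWedge := by
  obtain ⟨U, T, M, A, hHR⟩ := h
  exact ⟨U, T.drop01, M, hHR, T.separating_thetaWedge A hL⟩

/-- `Open_thetaReal34` is not derivable from the rest. -/
theorem exists_model_not_thetaReal34 (hL : Lemma33bLandherr)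
    (h : ∃ (U : Universe) (T : U.ThetaModel), U.ModelAxioms ∧ T.Inputs ∧ U.Fact_hodgeRiemann20) :
    ∃ (U : Universe) (T : U.ThetaModel), U.ModelAxioms ∧ U.Fact_hodgeRiemann20 ∧
      (T.Fact_embCover ∧ T.Fact_innerEmb ∧ T.Design_kappaConj ∧ T.Design_frameSignConj ∧ T.Open_thetaSub ∧
        T.Open_thetaWedge ∧ T.Open_thetaGen12 ∧ T.Open_chars ∧ T.Open_occ) ∧
      ¬ T.Open_thetaReal34 := by
  obtain ⟨U, T, M, A, hHR⟩ := h
  exact ⟨U, T.drop23, M, hHR, T.separating_thetaReal34 M A hHR hL⟩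

/-- `Open_thetaSub` is not derivable from the rest. -/
theorem exists_model_not_thetaSub (hL : Lemma33bLandherr)
    (h : ∃ (U : Universe) (T : U.ThetaModel), U.ModelAxioms ∧ T.Inputs ∧ U.Fact_hodgeRiemann20) :
    ∃ (U : Universe) (T : U.ThetaModel), U.ModelAxioms ∧ U.Fact_hodgeRiemann20 ∧
      (T.Fact_embCover ∧ T.Fact_innerEmb ∧ T.Design_kappaConj ∧ T.Design_frameSignConj ∧ T.Open_thetaWedge ∧
        T.Open_thetaGen12 ∧ T.Open_thetaReal34 ∧ T.Open_chars ∧ T.Open_occ) ∧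
      ¬ T.Open_thetaSub := by
  obtain ⟨U, T, M, A, hHR⟩ := h
  exact ⟨U, T.conj02, M, hHR, T.separating_thetaSub M.pull_hodge A hL⟩

end HodgeCM

end
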